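import Literature.NumberTheory.LFunctions.MoebiusAutomaticPowerRoots
import Literature.NumberTheory.LFunctions.AutomaticSequenceTransducerRelabel
import HarnessLib

/-!
# From the relabelled root estimate to `RootAPEstimate` (Müllner 2017, Prop. 3.2: labelling invariance; proved)

Everything in this file is PROVED. Müllner's §4 proves Prop. 3.2 for the transducer in the good
labelling of §2 (outputs `T̄ = Tρ ρ`, `MinImage.Tρ`), while the tree's reduction of the named
fact `mullner_moebius_automatic` (`MoebiusAutomaticRootReduction.lean`,
`mullner_moebius_automatic_of_rootAPEstimate_zeroStable`) consumes `RootAPEstimate` for the PLAIN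
outputs `T(M, (n)_k)` at a zero-stable root `M`. For a relabelling with `ρ_M = 1` one has
`T(M, w) = T̄(M, w) ≫ ρ_{δ(M,w)}⁻¹`, and the end state `δ(M, (n)_k)` is determined by the lowest
`L` digits of `n` as soon as these contain a synchronizing word (Müllner §3.1: "we fix the last
digits"; the exceptional residues are `O(k^{(1-η)L})`, Deshouillers–Drmota–Müllner). Hence:

* `MinImage.rootAPEstimate_of_rootSumρ` — if for every output `π`, modulus `q ≥ 1`, residue
  `c` and `ε > 0` the relabelled sums `∑_{n<x, n≡c (q), T̄(M,(n)_k) = π} μ(n)` are eventually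
  `≤ ε x`, then `RootAPEstimate k δ M` (plain outputs).

## References
* C. Müllner, Duke Math. J. 166 (2017) = arXiv:1602.03042: Prop. 3.2, §3.1 (fixing the last
  `λ₂` digits), Prop. 2.6 (relabelling). [Mullner2017]
-/

noncomputable section

open Finset
open scoped ArithmeticFunction.Moebius

namespace Literature.NumberTheory.LFunctions

/-- Counting one residue class below `x`: `#{n < x : n ≡ r (K)} ≤ x / K + 1`. [folklore] -/
theorem card_filter_range_mod_eq_le (K r x : ℕ) :
    ((range x).filter fun n => n % K = r).card ≤ x / K + 1 := by
  rw [← card_range (x / K + 1)]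
  refine card_le_card_of_injOn (fun n => n / K) (fun n hn => ?_) ?_
  · rw [mem_coe, mem_filter, mem_range] at hn
    rw [mem_coe, mem_range]
    exact Nat.lt_succ_of_le (Nat.div_le_div_right hn.1.le)
  · intro n₁ h₁ n₂ h₂ h
    rw [mem_coe, mem_filter] at h₁ h₂
    simp only at h
    rw [← Nat.div_add_mod n₁ K, ← Nat.div_add_mod n₂ K, h, h₁.2, h₂.2]

namespace MinImage

variable {σ : Type*} [Fintype σ] [DecidableEq σ] {δ : σ → ℕ → σ} {k : ℕ}

/-- With `ρ_M = 1`, the plain output is the relabelled one followed by `ρ_{δ(M,w)}⁻¹`: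
`T(M, w) = T̄(M, w) ≫ ρ_{δ(M,w)}⁻¹`. [cite: Mullner2017, Prop. 2.6] -/
theorem T_eq_Tρ_trans_symm (ρ : MinImage δ → Equiv.Perm (Fin (minRank δ))) {M : MinImage δ}
    (hρ : ρ M = 1) (w : List ℕ) : M.T w = (M.Tρ ρ w).trans (ρ (M.next w)).symm := by
  rw [Tρ, hρ, Equiv.trans_assoc, Equiv.self_trans_symm, Equiv.trans_refl, ← Equiv.Perm.inv_def, inv_one,
    one_trans_eq]

/-- **Digits above a fixed low block**: for `n ≥ K = k^L` with `n mod K = r`, the digit word of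
`n` is that of `⌊n/K⌋` followed by the padded block of `r`. [folklore] -/
theorem digits_reverse_eq_append {L n : ℕ} (hk : 1 < k) (hn : k ^ L ≤ n) :
    (Nat.digits k n).reverse = (Nat.digits k (n / k ^ L)).reverse ++ msbBlock k L (n % k ^ L) := by
  have hK : 0 < k ^ L := pow_pos (by omega) L
  have hm : 0 < n / k ^ L := Nat.div_pos hn hK
  conv_lhs => rw [← Nat.mod_add_div n (k ^ L)]
  rw [digits_add_pow_mul hk (Nat.mod_lt n hK) hm, List.reverse_append, msbBlock]

/-- **Labelling invariance of the root estimate** (Prop. 3.2 is about the relabelled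
transducer; the tree's reduction uses plain outputs). Let `M` be zero-stable and `ρ` a
relabelling with `ρ_M = 1`. If for all `π, q ≥ 1, c, ε > 0` eventually
`|∑_{n<x, n≡c (q), T̄(M,(n)_k) = π} μ(n)| ≤ ε x`, then `RootAPEstimate k δ M`: split `n` by its
residue `r` mod `K = k^L`; for the residues whose block contains a synchronizing word the end
state is fixed and `[T = π] = [T̄ = π ≫ ρ_{N_r}]` (up to `n < K`), a union of classes mod `Kq`;
the other residues are `≤ (ε/4) K` in number. [cite: Mullner2017, Prop. 3.2 with §3.1] -/
theorem rootAPEstimate_of_rootSumρ (hk : 2 ≤ k) (htriv : ∀ q d, k ≤ d → δ q d = q)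
    (M : MinImage δ) (ρ : MinImage δ → Equiv.Perm (Fin (minRank δ))) (hρ : ρ M = 1)
    (H : ∀ (π : Equiv.Perm (Fin (minRank δ))) (q : ℕ), 0 < q → ∀ (c : ℕ) (ε : ℝ), 0 < ε →
      ∃ x₀ : ℕ, ∀ x : ℕ, x₀ ≤ x →
        ‖∑ n ∈ (range x).filter (fun n => n % q = c ∧ M.Tρ ρ ((Nat.digits k n).reverse) = π),
          (μ n : ℂ)‖ ≤ ε * x) :
    RootAPEstimate k δ M := by
  classical
  intro π q hq c ε hε
  have hk1 : 1 < k := hk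
  have hk0 : 0 < k := by omega
  -- a synchronizing digit word and the level `L`
  obtain ⟨w₀, hw₀d, -, hw₀⟩ := exists_sync_digit_word (δ := δ) htriv hk0
  obtain ⟨L, hL⟩ := exists_card_syncBad_le hk1 hw₀d (η := ε / 4) (by positivity)
  set K := k ^ L with hK
  have hKpos : 0 < K := pow_pos hk0 L
  have hKq : 0 < K * q := Nat.mul_pos hKpos hq
  -- the end state and the target output on each residue
  set N : ℕ → MinImage δ := fun r => M.next (msbBlock k L r) with hN
  set πr : ℕ → Equiv.Perm (Fin (minRank δ)) := fun r => π.trans (ρ (N r)) with hπr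
  -- uniform thresholds for the finitely many relabelled sums
  set ε' : ℝ := ε / (4 * K * (K * q)) with hε'
  have hε'pos : 0 < ε' := by positivity
  choose x₀ hx₀ using fun (r s : ℕ) => H (πr r) (K * q) hKq s ε' hε'pos
  set X₀ : ℕ := (range K).sup fun r => (range (K * q)).sup fun s => x₀ r s with hX₀
  have hX₀le : ∀ r < K, ∀ s < K * q, x₀ r s ≤ X₀ := fun r hr s hs =>
    (le_sup (f := fun s => x₀ r s) (mem_range.2 hs)).trans
      (le_sup (f := fun r => (range (K * q)).sup fun s => x₀ r s) (mem_range.2 hr))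
  obtain ⟨X₁, hX₁⟩ := exists_nat_gt ((2 * (K : ℝ) * K + ε / 4 * K) / (ε / 4))
  refine ⟨max X₀ X₁, fun x hx => ?_⟩
  have hxX₀ : X₀ ≤ x := (le_max_left _ _).trans hx
  have hconst : 2 * (K : ℝ) * K + ε / 4 * K ≤ ε / 4 * x := by
    have : (2 * (K : ℝ) * K + ε / 4 * K) / (ε / 4) ≤ x :=
      hX₁.le.trans (by exact_mod_cast (le_max_right _ _).trans hx)
    rw [div_le_iff₀ (by positivity)] at this
    linarith
  -- the predicate and its residue pieces
  set P : ℕ → Prop := fun n => n % q = c ∧ M.T ((Nat.digits k n).reverse) = π with hP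
  set S : ℕ → ℂ := fun r => ∑ n ∈ (range x).filter (fun n => n % K = r ∧ P n), (μ n : ℂ) with hS
  have hsplit : ∑ n ∈ (range x).filter P, (μ n : ℂ) = ∑ r ∈ range K, S r := by
    rw [← sum_fiberwise_of_maps_to (g := fun n => n % K) (t := range K)
      (fun n _ => mem_range.2 (Nat.mod_lt n hKpos))]
    refine sum_congr rfl fun r _ => ?_
    rw [hS, filter_filter]
    exact sum_congr (filter_congr fun n _ => by tauto) fun _ _ => rfl
  -- (1) bad residues: trivial bound
  have hbad : ∀ r : ℕ, ‖S r‖ ≤ (x : ℝ) / K + 1 := by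
    intro r
    calc ‖S r‖ ≤ (((range x).filter fun n => n % K = r ∧ P n).card : ℝ) := by
          rw [hS]
          refine (norm_sum_le _ _).trans ?_
          have : ∀ n ∈ (range x).filter (fun n => n % K = r ∧ P n), ‖(μ n : ℂ)‖ ≤ 1 :=
            fun n _ => norm_moebius_cast_le_one n
          refine (sum_le_sum this).trans ?_
          simp
      _ ≤ (((range x).filter fun n => n % K = r).card : ℝ) := by
          exact_mod_cast card_le_card (fun n hn => by
            rw [mem_filter] at hn ⊢; exact ⟨hn.1, hn.2.1⟩)
      _ ≤ ((x / K + 1 : ℕ) : ℝ) := by exact_mod_cast card_filter_range_mod_eq_le K r x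
      _ ≤ (x : ℝ) / K + 1 := by push_cast; gcongr; exact Nat.cast_div_le
  -- (2) good residues: compare with the relabelled sums
  have hgood : ∀ r < K, r ∉ syncBad k L w₀ → ‖S r‖ ≤ 2 * K + (K * q) * (ε' * x) := by
    intro r hr hgood
    have hinf : w₀ <:+: msbBlock k L r := by
      by_contra h; exact hgood (mem_syncBad.2 ⟨hr, h⟩)
    -- on `n ≥ K` with `n % K = r`: end state `N r`, and `T = π ↔ T̄ = πr r`
    have hkey : ∀ n : ℕ, K ≤ n → n % K = r →
        (M.T ((Nat.digits k n).reverse) = π ↔ M.Tρ ρ ((Nat.digits k n).reverse) = πr r) := by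
      intro n hn hnr
      have hnext : M.next ((Nat.digits k n).reverse) = N r := by
        rw [digits_reverse_eq_append hk1 (hK ▸ hn), next_append, ← hK, hnr]
        exact next_eq_next_of_infix _ _ hw₀ hinf
      rw [T_eq_Tρ_trans_symm ρ hρ, hnext]
      simp only [hπr]
      constructor
      · intro h; rw [← h, Equiv.trans_assoc, Equiv.symm_trans_self, Equiv.trans_refl]
      · intro h; rw [h, Equiv.trans_assoc, Equiv.self_trans_symm, Equiv.trans_refl]
    -- the relabelled predicate
    set P' : ℕ → Prop := fun n => n % q = c ∧ M.Tρ ρ ((Nat.digits k n).reverse) = πr r with hP'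
    set S' : ℂ := ∑ n ∈ (range x).filter (fun n => n % K = r ∧ P' n), (μ n : ℂ) with hS'
    -- `S r` and `S'` agree above `K`
    have hdiff : ‖S r - S'‖ ≤ 2 * K := by
      have hsplit₁ : ∀ (Q : ℕ → Prop) [DecidablePred Q],
          ∑ n ∈ (range x).filter (fun n => n % K = r ∧ Q n), (μ n : ℂ) =
            ∑ n ∈ (range x).filter (fun n => n < K ∧ (n % K = r ∧ Q n)), (μ n : ℂ) +
            ∑ n ∈ (range x).filter (fun n => K ≤ n ∧ (n % K = r ∧ Q n)), (μ n : ℂ) := by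
        intro Q _
        rw [← sum_filter_add_sum_filter_not ((range x).filter fun n => n % K = r ∧ Q n) (fun n => n < K),
          filter_filter, filter_filter]
        congr 1
        · exact sum_congr (filter_congr fun n _ => by tauto) fun _ _ => rfl
        · exact sum_congr (filter_congr fun n _ => by rw [not_lt]; tauto) fun _ _ => rfl
      have heq : ((range x).filter fun n => K ≤ n ∧ (n % K = r ∧ P n)) =
          (range x).filter fun n => K ≤ n ∧ (n % K = r ∧ P' n) := by
        refine filter_congr fun n _ => ?_
        simp only [hP, hP']
        constructor
        · rintro ⟨h1, h2, h3, h4⟩; exact ⟨h1, h2, h3, (hkey n h1 h2).1 h4⟩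
        · rintro ⟨h1, h2, h3, h4⟩; exact ⟨h1, h2, h3, (hkey n h1 h2).2 h4⟩
      simp only [hS, hS']
      rw [hsplit₁ P, hsplit₁ P', heq, add_sub_add_right_eq_sub]
      have hsmall : ∀ (Q : ℕ → Prop) [DecidablePred Q],
          ‖∑ n ∈ (range x).filter (fun n => n < K ∧ (n % K = r ∧ Q n)), (μ n : ℂ)‖ ≤ K := by
        intro Q _
        calc _ ≤ (((range x).filter fun n => n < K ∧ (n % K = r ∧ Q n)).card : ℝ) := by
              refine (norm_sum_le _ _).trans ?_
              refine (sum_le_sum fun n _ => norm_moebius_cast_le_one n).trans ?_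
              simp
          _ ≤ ((range K).card : ℝ) := by
              exact_mod_cast card_le_card fun n hn => by
                rw [mem_filter] at hn; exact mem_range.2 hn.2.1
          _ = K := by rw [card_range]
      calc _ ≤ _ := norm_sub_le _ _
        _ ≤ K + K := add_le_add (hsmall P) (hsmall P')
        _ = 2 * K := by ring
    -- `S'` splits into classes mod `K q`
    have hS'le : ‖S'‖ ≤ (K * q) * (ε' * x) := by
      set t : Finset ℕ := (range (K * q)).filter fun s => s % K = r ∧ s % q = c with ht
      have hmaps : ∀ n ∈ (range x).filter (fun n => n % K = r ∧ P' n), n % (K * q) ∈ t := by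
        intro n hn
        rw [mem_filter] at hn
        rw [ht, mem_filter, mem_range]
        refine ⟨Nat.mod_lt _ hKq, ?_, ?_⟩
        · rw [Nat.mod_mul_right_mod]; exact hn.2.1
        · rw [Nat.mod_mul_left_mod]; exact hn.2.2.1
      rw [hS', ← sum_fiberwise_of_maps_to hmaps]
      have hfib : ∀ s ∈ t, ∑ n ∈ ((range x).filter (fun n => n % K = r ∧ P' n)).filter
          (fun n => n % (K * q) = s), (μ n : ℂ) =
          ∑ n ∈ (range x).filter (fun n => n % (K * q) = s ∧
            M.Tρ ρ ((Nat.digits k n).reverse) = πr r), (μ n : ℂ) := by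
        intro s hs
        rw [ht, mem_filter] at hs
        rw [filter_filter]
        refine sum_congr (filter_congr fun n _ => ?_) fun _ _ => rfl
        simp only [hP']
        constructor
        · rintro ⟨⟨-, -, h3⟩, h4⟩; exact ⟨h4, h3⟩
        · rintro ⟨h4, h3⟩
          refine ⟨⟨?_, ?_, h3⟩, h4⟩
          · rw [← Nat.mod_mul_right_mod, h4]; exact hs.2.1
          · rw [← Nat.mod_mul_left_mod, h4]; exact hs.2.2
      calc ‖∑ s ∈ t, ∑ n ∈ ((range x).filter (fun n => n % K = r ∧ P' n)).filter
            (fun n => n % (K * q) = s), (μ n : ℂ)‖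
          ≤ ∑ s ∈ t, ‖∑ n ∈ ((range x).filter (fun n => n % K = r ∧ P' n)).filter
            (fun n => n % (K * q) = s), (μ n : ℂ)‖ := norm_sum_le _ _
        _ ≤ ∑ s ∈ t, ε' * x := by
            refine sum_le_sum fun s hs => ?_
            rw [hfib s hs]
            have hs' : s < K * q := by rw [ht, mem_filter, mem_range] at hs; exact hs.1
            exact hx₀ r s x ((hX₀le r hr s hs').trans hxX₀)
        _ = t.card * (ε' * x) := by rw [sum_const, nsmul_eq_mul]
        _ ≤ (K * q) * (ε' * x) := by
            gcongr
            exact_mod_cast (card_filter_le _ _).trans (card_range _).le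
    calc ‖S r‖ = ‖(S r - S') + S'‖ := by rw [sub_add_cancel]
      _ ≤ ‖S r - S'‖ + ‖S'‖ := norm_add_le _ _
      _ ≤ 2 * K + (K * q) * (ε' * x) := add_le_add hdiff hS'le
  -- (3) assemble
  rw [hsplit]
  set Bad := syncBad k L w₀ with hBad
  have hL' : (Bad.card : ℝ) ≤ ε / 4 * K := by rw [hK]; push_cast; exact hL
  calc ‖∑ r ∈ range K, S r‖ ≤ ∑ r ∈ range K, ‖S r‖ := norm_sum_le _ _
    _ = ∑ r ∈ (range K).filter (fun r => r ∈ Bad), ‖S r‖ +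
          ∑ r ∈ (range K).filter (fun r => r ∉ Bad), ‖S r‖ :=
        (sum_filter_add_sum_filter_not _ _ _).symm
    _ ≤ ∑ r ∈ (range K).filter (fun r => r ∈ Bad), ((x : ℝ) / K + 1) +
          ∑ r ∈ (range K).filter (fun r => r ∉ Bad), (2 * K + (K * q) * (ε' * x)) := by
        gcongr with r hr r hr
        · exact hbad r
        · rw [mem_filter, mem_range] at hr; exact hgood r hr.1 hr.2
    _ ≤ Bad.card * ((x : ℝ) / K + 1) + K * (2 * K + (K * q) * (ε' * x)) := by
        rw [sum_const, sum_const, nsmul_eq_mul, nsmul_eq_mul]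
        gcongr
        · exact fun r hr => (mem_filter.1 hr).2
        · exact_mod_cast (card_filter_le _ _).trans (card_range K).le
    _ ≤ ε / 4 * K * ((x : ℝ) / K + 1) + K * (2 * K + (K * q) * (ε' * x)) := by gcongr
    _ = ε / 4 * x + (2 * K * K + ε / 4 * K) + ε / 4 * x := by
        rw [hε']; field_simp; ring
    _ ≤ ε / 4 * x + ε / 4 * x + ε / 4 * x := by linarith
    _ ≤ ε * x := by nlinarith [Nat.cast_nonneg (α := ℝ) x, hε.le]

end MinImage

end Literature.NumberTheory.LFunctions
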